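import Summits.QuantumFields.YangMills.Theorems.LuscherReductionDressedRitzPolyakovLiftClusterInduction
import HarnessLib

/-!
# CLUSTER INDUCTION — a linear majorant of the recursion `clusterDelta` (F9 shell input for S-PSCAL″ of crux `DressedRitz`, stmt-QuantumFields-20205,
# line «polyakovlift» r7; LEAD prover ym-lead-20205-polyakovlift g2)

`clusterDelta M κ ε s` is the recursion `δ_0 = s + Aε²`, `δ_{n+1} = s + A(ε + √δ_n)²`, `A = 2M(1+κ) + 1`.  Since `(ε + √δ)² ≤ 2ε² + 2δ`, it is dominated by a
GEOMETRIC recursion: ★ `clusterDelta_le_geom`: `δ_n ≤ (2A+1)^{n+1}·(s + 2Aε²)` — LINEAR in the first-moment defect `s` and in `ε²`, which is the form in which the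
quantifier shell of `PScalingExistsForL` makes `δ_M ≤ Λ²/4` and `M(ε + δ_M) ≤ 1/2` hold (`s = O(Λ/L + e^{−Λ^{−1/4}})`, `ε = O(1/L² + e^{−Λ^{−1/4}})`).

HONEST FRAMING: arithmetic; nothing here bears on infinite volume, the continuum limit or the Clay gap.
References: Reed–Simon IV, Thm. XIII.1 [cite: ReedSimonIV1978, Thm. XIII.1].
-/

set_option autoImplicit false

noncomputable section

namespace Summit.QuantumFields.YangMills.Theorems.FemtoTransferGap.ClusterInd

variable {M : ℕ} {κ ε s : ℝ}

/-- `(ε + √δ)² ≤ 2ε² + 2δ` for `δ ≥ 0`. [folklore] -/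
theorem sq_add_sqrt_le {ε δ : ℝ} (hδ : 0 ≤ δ) : (ε + Real.sqrt δ) ^ 2 ≤ 2 * ε ^ 2 + 2 * δ := by
  have h := Real.sq_sqrt hδ
  nlinarith [sq_nonneg (ε - Real.sqrt δ), Real.sqrt_nonneg δ]

/-- ★ **Geometric majorant**: `clusterDelta M κ ε s n ≤ (2A+1)^{n+1}·(s + 2Aε²)`, `A = 2M(1+κ)+1`. [folklore] -/
theorem clusterDelta_le_geom (hκ : 0 ≤ κ) (hs : 0 ≤ s) (n : ℕ) :
    clusterDelta M κ ε s n ≤ (2 * (2 * M * (1 + κ) + 1) + 1) ^ (n + 1) * (s + 2 * (2 * M * (1 + κ) + 1) * ε ^ 2) := by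
  set A : ℝ := 2 * M * (1 + κ) + 1 with hA
  have hA1 : 1 ≤ A := by rw [hA]; nlinarith [Nat.cast_nonneg (α := ℝ) M]
  have hA0 : 0 ≤ A := le_trans zero_le_one hA1
  have hT0 : 0 ≤ s + 2 * A * ε ^ 2 := by positivity
  induction n with
  | zero =>
    show s + A * ε ^ 2 ≤ (2 * A + 1) ^ (0 + 1) * (s + 2 * A * ε ^ 2)
    rw [zero_add, pow_one]
    nlinarith [sq_nonneg ε]
  | succ n ih =>
    have hδ0 : 0 ≤ clusterDelta M κ ε s n := clusterDelta_nonneg hκ hs n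
    show s + A * (ε + Real.sqrt (clusterDelta M κ ε s n)) ^ 2 ≤ (2 * A + 1) ^ (n + 1 + 1) * (s + 2 * A * ε ^ 2)
    have h1 : A * (ε + Real.sqrt (clusterDelta M κ ε s n)) ^ 2 ≤ A * (2 * ε ^ 2 + 2 * clusterDelta M κ ε s n) :=
      mul_le_mul_of_nonneg_left (sq_add_sqrt_le hδ0) hA0
    have hP1 : 1 ≤ (2 * A + 1) ^ (n + 1) := one_le_pow₀ (by linarith)
    have h2 : 2 * A * clusterDelta M κ ε s n ≤ 2 * A * ((2 * A + 1) ^ (n + 1) * (s + 2 * A * ε ^ 2)) :=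
      mul_le_mul_of_nonneg_left ih (by positivity)
    have e : (2 * A + 1) ^ (n + 1 + 1) * (s + 2 * A * ε ^ 2) =
        (2 * A + 1) ^ (n + 1) * (s + 2 * A * ε ^ 2) + 2 * A * ((2 * A + 1) ^ (n + 1) * (s + 2 * A * ε ^ 2)) := by ring
    rw [e]
    have h3 : s + 2 * A * ε ^ 2 ≤ (2 * A + 1) ^ (n + 1) * (s + 2 * A * ε ^ 2) := by
      have := mul_le_mul_of_nonneg_right hP1 hT0; linarith
    nlinarith [h1, h2, h3]

/-- The last value of the recursion, majorised: `clusterDelta M κ ε s M ≤ (2A+1)^{M+1}(s + 2Aε²)`. [folklore] -/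
theorem clusterDelta_top_le (hκ : 0 ≤ κ) (hs : 0 ≤ s) :
    clusterDelta M κ ε s M ≤ (2 * (2 * M * (1 + κ) + 1) + 1) ^ (M + 1) * (s + 2 * (2 * M * (1 + κ) + 1) * ε ^ 2) :=
  clusterDelta_le_geom hκ hs M

end Summit.QuantumFields.YangMills.Theorems.FemtoTransferGap.ClusterInd

end
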